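import Literature.MathematicalPhysics.QuantumLattice.XXZInfinitesimalFieldStatesMerminWagner
import Literature.MathematicalPhysics.QuantumLattice.AnisotropicXYGaussianDomination
import Mathlib.NumberTheory.Harmonic.Bounds
import HarnessLib

/-!
# The layered quantum XY model (weakly coupled planes of hard-core bosons): a Mermin–Wagner CEILING on the sourced
# planar magnetisation, `m² ≤ β S² [2S²(16 ΣK_∥/H_R + 8|K_⊥|R²) + 4S|B|R²]` uniformly in the volume — the
# in-plane order parameter of weakly coupled layers is `O(√(β/log(1/K_⊥)))`

Topic `Literature/MathematicalPhysics/QuantumLattice` (family `hubbard`; sequel of `XXZInfinitesimalFieldStatesMerminWagner`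
(Mermin–Wagner for the sourced XXZ model on `d ≤ 2` tori) and of the anisotropic-coupling XY files `AnisotropicXY*`
(`xyAnisoTorus L n K = -Σ_x Σ_i K_i (S¹_xS¹_{x+e_i} + S²_xS²_{x+e_i})`, Kennedy–Lieb–Shastry's model (5))).

THE QUESTION. The tree PROVES, by reflection positivity and infrared bounds, that the LAYERED quantum XY model — spin `S`
planes with in-plane coupling `1` stacked with interlayer coupling `r`, `K = (1, 1, r)`; for `S = ½` the hard-core Bose
gas on weakly coupled planes (Matsubara–Matsuda) — HAS planar long-range order at low temperature for every `0 < r ≤ 2`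
(`xyLayered_longRangeOrder`, `xyLayered_thermalOrderParameter_ge_spinHalf`: a FLOOR `≥ 1/8 − 869√2/10⁴` on the thermal
order parameter for `β ≥ β₀(r)`). This file PROVES the complementary CEILING, Mermin–Wagner's mechanism
[cite: MerminWagnerPRL1966, pp. 1133–1135] run with a test function living on ONE layer (Klein–Landau–Shucker's layered
cutoff [cite: KleinLandauShucker1981]): the planar magnetisation that an in-plane field `B` induces is bounded, uniformly
in the volume, by `β` times an in-plane cost `~ ΣK_∥/log R` plus an interlayer cost `~ |K_⊥| R²`; optimising the scale
`R` against the interlayer coupling, the order parameter of weakly coupled layers is `O(√(β/log(1/|K_⊥|)))` at every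
fixed temperature — it vanishes continuously as the layers decouple, and an order parameter of size `m₀` can only exist
at `β ≳ m₀² log(1/|K_⊥|)`. (For `K_⊥ = 0` and `R → ∞` it is the two-dimensional Mermin–Wagner theorem.)

## Contents (everything PROVED, standard axioms; no definition, no named fact)

* §1 **Mermin–Wagner for the XY model with arbitrary bond weights**, any torus `(ℤ/Lℤ)^d`, any field profile:
  the double commutator `[C,[K,C]] = Σ_e w_e (f_x−f_y)²(B⁰_e+B¹_e) + Σ_x b_x f_x² S^α_x` for
  `K = H_w − Σ_x b_x S^α_x`, `C = Σ_z f_z Sᶻ_z` (`doubleComm_xyWeighted_with_planarField`) and the local bound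
  `(Re⟨S^α_o⟩_{β,K})² ≤ β S² (2S² Σ_e |w_e|(f_x−f_y)² + S Σ_x |b_x| f_x²)` (`sq_re_gibbsState_planarSpin_le_xyWeighted`).
* §2 **layer geometry** on `(ℤ/Lℤ)^{m+1}` (layers `{x_{last} = c}` ≅ `(ℤ/Lℤ)^m` isometrically: `layerEmbed`,
  `torusDist_layerEmbed`, `sum_layer_eq_sum`), and the **one-layer test function** `f(x) = [x_{last} = o_{last}]·g(dist(x,o))`
  of a radial profile `g` (`layerProfile`): its direction-resolved Dirichlet sums are
  `Σ_x (f_x − f_{x+e_j})² ≤ 2 Σ_{v∈(ℤ/Lℤ)^m} (g(d_v) − g(d_v+1))²` for in-plane `j` (`sum_sq_sub_inPlane_le`) and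
  `Σ_x (f_x − f_{x+e_{last}})² = 2 Σ_x f_x²` (`sum_sq_sub_vertical_eq`, `sum_sq_layerProfile_eq`).
* §3 **THE LAYERED CEILING** (`sq_re_gibbsState_planarSpin_le_layered`): on `(ℤ/Lℤ)^{m+1}`, `m ∈ {1,2}`, `L ≥ 3`, for
  `K = H_K − B Σ_x S^α_x` (`H_K = xyAnisoTorus L n K`, `α ∈ {x,y}`), `β ≥ 0`, with the harmonic profile
  `g_R(r) = (Σ_{r≤k<R} 1/(k+1))/H_R`, every `R ≥ 1`, every site `o`:
  `(Re⟨S^α_o⟩_{β})² ≤ β S² (2S² (16 (Σ_{j<m}|K_j|)/H_R + 8|K_m| R²) + S |B| · 4R²)`, `H_R = Σ_{k<R} 1/(k+1)`, uniformly in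
  `L`; the three-dimensional layered form `sq_re_gibbsState_planarSpin_le_layered_three` (`K = (K₀, K₁, K_⊥)`).
* §4 **INFINITE VOLUME** (KT93 (1.8) states of the layered model, the tree's generic `XXZKT.IsSourcedLimit` /
  `XXZKT.IsInfinitesimalFieldState` over the sourced Gibbs family; the transfer `…_of_one_le` uses only tori of side `≥ 4`):
  every sourced thermal limit state obeys the same ceiling at every site (`layeredXY_sourcedLimit_sq_re_expect_le`), every
  infinitesimal-field state obeys it WITHOUT the field term (`layeredXY_infinitesimalField_sq_re_expect_le`):
  `(Re ω̃(S^α_x))² ≤ β S²·2S²(16ΣK_∥/H_R + 8|K_⊥|R²)` for every `R ≥ 1` — hence `ω̃(S^α_x) = 0` for decoupled layers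
  (`K_⊥ = 0`, `layeredXY_infinitesimalField_expect_eq_zero_of_decoupled`: the two-dimensional theorem) and `→ 0` UNIFORMLY as
  `K_⊥ → 0` at fixed `β` and in-plane budget (`layeredXY_infinitesimalField_sq_re_expect_le_of_interlayer_small`: `∀ ε ∃ δ`);
  such states exist (`exists_layeredXY_infinitesimalFieldState`).
* §5 the explicit logarithm `H_R ≥ log(R+1)` (`log_succ_le_harmonicSum`, from Mathlib's `log_add_one_le_harmonic`) and the
  `1/log` law `(Re ω̃(S^α_x))² ≤ β S²·2S²(16ΣK_∥/log(R+1) + 8|K_⊥|R²)` (`layeredXY_infinitesimalField_sq_re_expect_le_log`;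
  `R ≍ |K_⊥|^{-1/4}` gives `O(βS⁴(ΣK_∥+1)/log(1/|K_⊥|))`).

WHAT THIS IS NOT: a ceiling only — for `K_⊥ > 0` the layered model DOES order at low temperature (the tree's RP floor);
the two statements together say that an order parameter of size `m₀` in weakly coupled XY layers requires
`β ≳ m₀² log(1/K_⊥)` and is guaranteed (for `S = ½`, `0 < K_⊥ ≤ 2`) once `β ≥ β₀(K_⊥)`. Nothing here concerns the
Kosterlitz–Thouless (quasi-long-range) order of a single layer, and nothing is claimed about the Hubbard model.

## Mathlib / tree search

REUSED: `doubleComm_xxzBond_rotZ`, `doubleComm_siteSpin_planar_rotZ`, `abs_re_gibbsState_planarBondWeight_le`,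
`abs_re_gibbsState_field_smul_siteSpin_le`, `siteSpin_zero/one_comm_rotZ` (`XXZInfinitesimalFieldStatesMerminWagner`);
`bogoliubov_inequality`, `IsHermitian.re_gibbsState_doubleComm_nonneg`, `re_gibbsState_le_of_posSemidef`,
`posSemidef_sq_smul_one_sub_siteSpin_sq`, `sum_smul_siteSpin_isHermitian`; `sq_sub_le_of_step`, `sum_radial_le_sum_range`,
`sum_shell_harmonicProfile_sq_le`, `harmonicProfile_*`, `one_le_sum_range_one_div_succ`, `sum_range_two_mul_cast_add_one`
(`HeisenbergOrderMerminWagnerMagnetisationProofs`); `torusDist_le_of_adj` (`TorusTestPotential`); `xyWeightedHamiltonian`,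
`xyAnisoTorus`, `dirCoupling_mk_add_single`, `xyWeightedHamiltonian_isHermitian` (`AnisotropicXYGaussianDomination`);
`sum_edgeFinset_torusGraph` (`GaussianDomination`); `XXZKT.IsSourcedLimit`, `XXZKT.IsInfinitesimalFieldState`,
`XXZKT.exists_isInfinitesimalFieldState`, `XXZKT.siteSpinAt` (`XXZAntiferromagnetInfiniteVolumeOrder`).
`lean search 'layered|interlayer|xyAniso.*MerminWagner'` (2026-08-29): only the fermionic `LayeredEquilibriumStates*` files
(infinite-volume rows) and the RP floors `AnisotropicXY*` — no ceiling for the quantum layered XY model.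

## References

* N. D. Mermin, H. Wagner, Phys. Rev. Lett. 17 (1966) 1133–1136, pp. 1133–1135 (Bogoliubov inequality, double
  commutator, the bound `|s| < const (T|ln h|)^{-1/2}` in `d = 2`). [cite: MerminWagnerPRL1966, pp. 1133–1135]
* A. Klein, L. J. Landau, D. S. Shucker, J. Stat. Phys. 26 (1981) 505–512 (cutoff functions; layered remark).
  [cite: KleinLandauShucker1981]
* T. Kennedy, E. H. Lieb, B. S. Shastry, J. Stat. Phys. 53 (1988) 1019, eq. (5) (direction-dependent couplings) and
  Phys. Rev. Lett. 61 (1988) 2582 (XY model / hard-core bosons). [cite: KLS1988JSP, eq. (5)] [cite: KLS1988PRL, eq. (1)]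
* T. Koma, H. Tasaki, Commun. Math. Phys. 158 (1993) 191, §1 (1.8)–(1.9) (infinitesimal-field states).
  [cite: KomaTasaki1993, §1 (1.8)–(1.9)]
* T. Matsubara, H. Matsuda, Prog. Theor. Phys. 16 (1956) 569 (hard-core bosons = spin-½ XY). [cite: MatsubaraMatsuda1956]
-/

noncomputable section

namespace Literature.MathematicalPhysics.QuantumLattice

open Finset Matrix Complex _root_.Filter Literature.Probability.LatticeModels
  Literature.MathematicalPhysics.QuantumLattice.SpinOperators
open scoped ComplexOrder MatrixOrder _root_.Topology

/-! ### §1 Mermin–Wagner for the XY model with arbitrary bond weights and an arbitrary planar field -/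

section Weighted

variable {d : ℕ} (L : ℕ) [NeZero L] (n : ℕ)

/-- `xyBond = B⁰ + B¹ + 0·B²` (to feed the XXZ double-commutator lemma with `Δ = 0`). [folklore] -/
private theorem xyBond_eq_xxzBond_zero (x y : TorusSite d L) :
    (xyBond n x y : Op (TorusSite d L) (n + 1)) = spinBond n 0 x y + spinBond n 1 x y + (0 : ℂ) • spinBond n 2 x y := by
  rw [xyBond, zero_smul, add_zero]

/-- **Mermin–Wagner's double commutator for the XY model with bond weights `w` in a planar field with profile `b`:**
for `K = H_w − Σ_x b_x S^α_x` (`H_w = −Σ_e w_e (S⁰_xS⁰_y + S¹_xS¹_y)`, `α ∈ {x, y}`) and `C = Σ_z f_z Sᶻ_z`,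
`C(KC − CK) − (KC − CK)C = Σ_e w_e (f_x − f_y)² (B⁰_e + B¹_e) + Σ_x b_x f_x² S^α_x`.
[cite: MerminWagnerPRL1966, p. 1134] -/
theorem doubleComm_xyWeighted_with_planarField (w : Sym2 (TorusSite d L) → ℝ) (f : TorusSite d L → ℂ)
    (b : TorusSite d L → ℂ) {α : Fin 3} (hα : α ≠ 2) (C K : Op (TorusSite d L) (n + 1))
    (hC : C = ∑ z, f z • siteSpin n z 2) (hK : K = xyWeightedHamiltonian L n w - ∑ x, b x • siteSpin n x α) :
    C * (K * C - C * K) - (K * C - C * K) * C =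
      (∑ e ∈ (torusGraph d L).edgeFinset, ((w e : ℝ) : ℂ) •
          Sym2.lift ⟨fun x y => (f x - f y) ^ 2 • (spinBond n 0 x y + spinBond n 1 x y), planarBondWeight_symm n f⟩ e) +
        ∑ x, (b x * (f x) ^ 2) • siteSpin n x α := by
  set D : Op (TorusSite d L) (n + 1) →ₗ[ℂ] Op (TorusSite d L) (n + 1) :=
    LinearMap.mulRight ℂ C - LinearMap.mulLeft ℂ C with hD
  have hDapp : ∀ Z : Op (TorusSite d L) (n + 1), D Z = Z * C - C * Z := fun Z => rfl
  have key : C * (K * C - C * K) - (K * C - C * K) * C = -(D (D K)) := by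
    simp only [hDapp]
    noncomm_ring
  rw [key, hK]
  simp only [map_sub, map_smul, xyWeightedHamiltonian, map_sum]
  have hedge : ∀ e ∈ (torusGraph d L).edgeFinset,
      D (D (Sym2.lift ⟨fun x y => -xyBond n x y, fun x y => by dsimp only; rw [xyBond_comm]⟩ e)) =
        -Sym2.lift ⟨fun x y => (f x - f y) ^ 2 • (spinBond n 0 x y + spinBond n 1 x y), planarBondWeight_symm n f⟩ e := by
    intro e _
    induction e using Sym2.ind with
    | h x y =>
      rw [Sym2.lift_mk, Sym2.lift_mk, map_neg, map_neg, xyBond_eq_xxzBond_zero, hDapp, hDapp,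
        doubleComm_xxzBond_rotZ n f 0 x y C hC]
  have hfield : ∀ x ∈ (univ : Finset (TorusSite d L)),
      b x • D (D (siteSpin n x α)) = (b x * (f x) ^ 2) • siteSpin n x α := by
    intro x _
    rw [hDapp, hDapp, doubleComm_siteSpin_planar_rotZ n f x hα C hC, smul_smul]
  have hsum1 : ∑ e ∈ (torusGraph d L).edgeFinset,
      ((w e : ℝ) : ℂ) • D (D (Sym2.lift ⟨fun x y => -xyBond n x y, fun x y => by dsimp only; rw [xyBond_comm]⟩ e)) =
        -∑ e ∈ (torusGraph d L).edgeFinset, ((w e : ℝ) : ℂ) •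
          Sym2.lift ⟨fun x y => (f x - f y) ^ 2 • (spinBond n 0 x y + spinBond n 1 x y), planarBondWeight_symm n f⟩ e := by
    rw [← Finset.sum_neg_distrib]
    exact Finset.sum_congr rfl fun e he => by rw [hedge e he, smul_neg]
  rw [hsum1, Finset.sum_congr rfl hfield]
  abel

/-- `K = H_w − Σ_x b_x S^α_x` is Hermitian for real weights and field strengths. [cite: MerminWagnerPRL1966, eq. (1)] -/
theorem xyWeightedHamiltonian_sub_field_isHermitian (w : Sym2 (TorusSite d L) → ℝ) (b : TorusSite d L → ℝ) (α : Fin 3) :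
    (xyWeightedHamiltonian L n w - ∑ x, ((b x : ℝ) : ℂ) • siteSpin n x α : Op (TorusSite d L) (n + 1)).IsHermitian :=
  (xyWeightedHamiltonian_isHermitian L n w).sub (sum_smul_siteSpin_isHermitian n b α)

/-- **THE LOCAL MERMIN–WAGNER BOUND FOR THE WEIGHTED XY MODEL IN A PLANAR FIELD (any torus, any real bond weights,
any field profile, any real test function).** For `K = H_w − Σ_x b_x S^α_x`, `α ∈ {x, y}`, `β ≥ 0`, `f(o) = 1`:
`(Re⟨S^α_o⟩_{β,K})² ≤ β S² (2S² Σ_e |w_e| (f_x − f_y)² + S Σ_x |b_x| f_x²)` (`S = n/2`) — Bogoliubov's inequality with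
`C = Σ f_z Sᶻ_z` and the other planar component at `o`. [cite: MerminWagnerPRL1966, pp. 1133–1134] -/
theorem sq_re_gibbsState_planarSpin_le_xyWeighted (w : Sym2 (TorusSite d L) → ℝ) (b : TorusSite d L → ℝ)
    {α : Fin 3} (hα : α ≠ 2) {β : ℝ} (hβ : 0 ≤ β) (f : TorusSite d L → ℝ) (o : TorusSite d L) (hfo : f o = 1) :
    (gibbsState β (xyWeightedHamiltonian L n w - ∑ x, ((b x : ℝ) : ℂ) • siteSpin n x α) (siteSpin n o α)).re ^ 2 ≤
      β * ((n : ℝ) / 2) ^ 2 *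
        (2 * ((n : ℝ) / 2) ^ 2 *
            ∑ e ∈ (torusGraph d L).edgeFinset, |w e| * Sym2.lift ⟨fun x y => (f x - f y) ^ 2, fun x y => by ring⟩ e +
          (n : ℝ) / 2 * ∑ x, |b x| * (f x) ^ 2) := by
  set K : Op (TorusSite d L) (n + 1) := xyWeightedHamiltonian L n w - ∑ x, ((b x : ℝ) : ℂ) • siteSpin n x α with hKdef
  set C : Op (TorusSite d L) (n + 1) := ∑ z, ((f z : ℝ) : ℂ) • siteSpin n z 2 with hCdef
  set S : ℝ := (n : ℝ) / 2 with hSdef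
  set E : ℝ := ∑ e ∈ (torusGraph d L).edgeFinset, |w e| * Sym2.lift ⟨fun x y => (f x - f y) ^ 2, fun x y => by ring⟩ e
    with hEdef
  set F : ℝ := ∑ x, |b x| * (f x) ^ 2 with hFdef
  have hK : K.IsHermitian := xyWeightedHamiltonian_sub_field_isHermitian L n w b α
  have hC : C.IsHermitian := sum_smul_siteSpin_isHermitian n f 2
  haveI : Nonempty (TensorIndex (TorusSite d L) (n + 1)) := ⟨fun _ => 0⟩
  -- the partner component `A` and `CA - AC = u Ŝ^α_o` with `‖u‖ = 1`
  obtain ⟨a', u, hu, hCA⟩ : ∃ (a' : Fin 3) (u : ℂ), ‖u‖ = 1 ∧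
      C * siteSpin n o a' - siteSpin n o a' * C = u • siteSpin n o α := by
    have h : α = 0 ∨ α = 1 := by
      fin_cases α
      · exact Or.inl rfl
      · exact Or.inr rfl
      · exact absurd rfl hα
    rcases h with rfl | rfl
    · refine ⟨1, -I, by simp, ?_⟩
      rw [← neg_sub, siteSpin_one_comm_rotZ n (fun z => ((f z : ℝ) : ℂ)) o, hfo]
      simp
    · refine ⟨0, I, by simp, ?_⟩
      rw [← neg_sub, siteSpin_zero_comm_rotZ n (fun z => ((f z : ℝ) : ℂ)) o, hfo]
      simp
  set A : Op (TorusSite d L) (n + 1) := siteSpin n o a' with hAdef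
  have hA : A.IsHermitian := siteSpin_isHermitian n o a'
  -- Bogoliubov's inequality
  have hB := bogoliubov_inequality hK hA hC hβ
  have hLHS : (gibbsState β K (siteSpin n o α)).re ^ 2 ≤ ‖gibbsState β K (C * A - A * C)‖ ^ 2 := by
    rw [hCA, LinearMap.map_smul, smul_eq_mul, norm_mul, hu, one_mul]
    have h1 := Complex.abs_re_le_norm (gibbsState β K (siteSpin n o α))
    exact sq_le_sq' (by linarith [neg_abs_le (gibbsState β K (siteSpin n o α)).re])
      ((le_abs_self _).trans h1)
  -- `0 ≤ ⟨A²⟩ ≤ S²`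
  have hS2re : (((n : ℂ) / 2) ^ 2).re = S ^ 2 := by
    rw [show ((n : ℂ) / 2) ^ 2 = ((((n : ℝ) / 2) ^ 2 : ℝ) : ℂ) by push_cast; ring, Complex.ofReal_re]
  have hA2 : (gibbsState β K (A * A)).re ≤ S ^ 2 := by
    have := re_gibbsState_le_of_posSemidef hK β (posSemidef_sq_smul_one_sub_siteSpin_sq n o a')
    rwa [hS2re] at this
  -- the double commutator
  have hDC := doubleComm_xyWeighted_with_planarField L n w (fun z => ((f z : ℝ) : ℂ)) (fun x => ((b x : ℝ) : ℂ)) hα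
    C K hCdef hKdef
  have hDC0 : 0 ≤ (gibbsState β K (C * (K * C - C * K) - (K * C - C * K) * C)).re :=
    hK.re_gibbsState_doubleComm_nonneg hC hβ
  have hDCle : (gibbsState β K (C * (K * C - C * K) - (K * C - C * K) * C)).re ≤ 2 * S ^ 2 * E + S * F := by
    rw [hDC, map_add, map_sum, map_sum, Complex.add_re, Complex.re_sum, Complex.re_sum]
    refine add_le_add ?_ ?_
    · calc ∑ e ∈ (torusGraph d L).edgeFinset, (gibbsState β K (((w e : ℝ) : ℂ) • Sym2.lift ⟨fun x y =>
            (((f x : ℝ) : ℂ) - f y) ^ 2 • (spinBond n 0 x y + spinBond n 1 x y),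
              planarBondWeight_symm n fun z => (f z : ℂ)⟩ e)).re
          ≤ ∑ e ∈ (torusGraph d L).edgeFinset, |w e| * (2 * S ^ 2 *
            Sym2.lift ⟨fun x y => (f x - f y) ^ 2, fun x y => by ring⟩ e) := by
            refine Finset.sum_le_sum fun e _ => ?_
            rw [LinearMap.map_smul, smul_eq_mul, Complex.re_ofReal_mul]
            refine (le_abs_self _).trans ?_
            rw [abs_mul]
            exact mul_le_mul_of_nonneg_left (abs_re_gibbsState_planarBondWeight_le n hK β f e) (abs_nonneg _)
        _ = 2 * S ^ 2 * E := by
            rw [hEdef, Finset.mul_sum]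
            refine Finset.sum_congr rfl fun e _ => ?_
            ring
    · calc ∑ x, (gibbsState β K ((((b x : ℝ) : ℂ) * (((f x : ℝ) : ℂ)) ^ 2) • siteSpin n x α)).re
          ≤ ∑ x, |(gibbsState β K ((((b x : ℝ) : ℂ) * (((f x : ℝ) : ℂ)) ^ 2) • siteSpin n x α)).re| :=
            Finset.sum_le_sum fun x _ => le_abs_self _
        _ ≤ ∑ x, S * (|b x| * (f x) ^ 2) :=
            Finset.sum_le_sum fun x _ => abs_re_gibbsState_field_smul_siteSpin_le n hK β b f x α
        _ = S * F := by rw [← Finset.mul_sum, hFdef]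
  -- assemble
  have hSβ : 0 ≤ β * S ^ 2 := mul_nonneg hβ (sq_nonneg _)
  calc (gibbsState β K (siteSpin n o α)).re ^ 2
      ≤ ‖gibbsState β K (C * A - A * C)‖ ^ 2 := hLHS
    _ ≤ β * (gibbsState β K (A * A)).re *
          (gibbsState β K (C * (K * C - C * K) - (K * C - C * K) * C)).re := hB
    _ ≤ β * S ^ 2 * (gibbsState β K (C * (K * C - C * K) - (K * C - C * K) * C)).re := by
        refine mul_le_mul_of_nonneg_right (mul_le_mul_of_nonneg_left hA2 hβ) hDC0
    _ ≤ β * S ^ 2 * (2 * S ^ 2 * E + S * F) := mul_le_mul_of_nonneg_left hDCle hSβ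

/-- **Direction-resolved form for direction-dependent couplings** (`L ≥ 3`, so that every bond is `{x, x+e_i}` exactly
once): for `w = dirCoupling K`, `Σ_e |w_e|(f_x − f_y)² = Σ_i |K_i| Σ_x (f_x − f_{x+e_i})²`. [cite: KLS1988JSP, eq. (5)] -/
theorem sum_edgeFinset_abs_dirCoupling_mul_sq_sub (hL : 3 ≤ L) (K : Fin d → ℝ) (f : TorusSite d L → ℝ) :
    ∑ e ∈ (torusGraph d L).edgeFinset, |dirCoupling L K e| * Sym2.lift ⟨fun x y => (f x - f y) ^ 2, fun x y => by ring⟩ e =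
      ∑ i : Fin d, |K i| * ∑ x : TorusSite d L, (f x - f (x + Pi.single i 1)) ^ 2 := by
  rw [sum_edgeFinset_torusGraph hL, Finset.sum_comm]
  refine Finset.sum_congr rfl fun i _ => ?_
  rw [Finset.mul_sum]
  refine Finset.sum_congr rfl fun x _ => ?_
  rw [dirCoupling_mk_add_single L hL K x i, Sym2.lift_mk]

end Weighted

/-! ### §2 Layer geometry on `(ℤ/Lℤ)^{m+1}` and the one-layer harmonic test function -/

section Layers

variable {m : ℕ} (L : ℕ)

/-- The isometric embedding of the `m`-dimensional torus as the layer `{x_{last} = c}` of the `(m+1)`-dimensional torus.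
[cite: KleinLandauShucker1981] -/
def layerEmbed (c : ZMod L) (v : TorusSite m L) : TorusSite (m + 1) L :=
  Fin.snoc (α := fun _ => ZMod L) v c

/-- In-plane coordinates of an embedded site. [folklore] -/
@[simp] private theorem layerEmbed_castSucc (c : ZMod L) (v : TorusSite m L) (j : Fin m) :
    layerEmbed L c v (Fin.castSucc j) = v j := by
  simp [layerEmbed]

/-- The layer coordinate of an embedded site. [folklore] -/
@[simp] private theorem layerEmbed_last (c : ZMod L) (v : TorusSite m L) : layerEmbed L c v (Fin.last m) = c := by
  simp [layerEmbed]

/-- `layerEmbed` is injective. [folklore] -/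
private theorem layerEmbed_injective (c : ZMod L) : Function.Injective (layerEmbed (m := m) L c) := by
  intro v v' h
  funext j
  have := congrFun h (Fin.castSucc j)
  simpa using this

/-- A site of the layer `{x_{last} = c}` is the image of its first `m` coordinates. [folklore] -/
private theorem layerEmbed_init {c : ZMod L} {x : TorusSite (m + 1) L} (hx : x (Fin.last m) = c) :
    layerEmbed L c (Fin.init x) = x := by
  rw [← hx]
  exact Fin.snoc_init_self x

/-- The difference of two sites of one layer is the embedded difference in the layer `{x_{last} = 0}`. [folklore] -/
private theorem layerEmbed_sub (c : ZMod L) (v v' : TorusSite m L) :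
    layerEmbed L c v - layerEmbed L c v' = layerEmbed L 0 (v - v') := by
  funext i
  refine Fin.lastCases ?_ (fun j => ?_) i
  · simp
  · simp

/-- The torus norm of an in-layer vector is its `m`-dimensional torus norm. [folklore] -/
private theorem torusNorm_layerEmbed_zero (u : TorusSite m L) : torusNorm (layerEmbed L 0 u) = torusNorm u := by
  unfold torusNorm
  refine le_antisymm (Finset.sup_le fun i _ => ?_) (Finset.sup_le fun j _ => ?_)
  · refine Fin.lastCases ?_ (fun j => ?_) i
    · simp
    · rw [layerEmbed_castSucc]
      exact Finset.le_sup (f := fun j : Fin m => min (u j).val (L - (u j).val)) (Finset.mem_univ j)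
  · have := Finset.le_sup (f := fun i : Fin (m + 1) => min (layerEmbed L 0 u i).val (L - (layerEmbed L 0 u i).val))
      (Finset.mem_univ (Fin.castSucc j))
    simpa only [layerEmbed_castSucc] using this

/-- **The layers are isometric copies of the `m`-dimensional torus** (the periodic `ℓ^∞` distance of Friedli–Velenik
§3.1 restricted to a coordinate hyperplane). [cite: FriedliVelenik2017, §3.1] -/
theorem torusDist_layerEmbed (c : ZMod L) (v v' : TorusSite m L) :
    torusDist (layerEmbed L c v) (layerEmbed L c v') = torusDist v v' := by
  unfold torusDist
  rw [layerEmbed_sub, torusNorm_layerEmbed_zero]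

/-- The distance from an embedded site of the layer of `o` to `o` is the in-layer distance. [folklore] -/
private theorem torusDist_layerEmbed_self (o : TorusSite (m + 1) L) (v : TorusSite m L) :
    torusDist (layerEmbed L (o (Fin.last m)) v) o = torusDist v (Fin.init o) := by
  have ho : layerEmbed L (o (Fin.last m)) (Fin.init o) = o := layerEmbed_init L rfl
  rw [show torusDist (layerEmbed L (o (Fin.last m)) v) o =
      torusDist (layerEmbed L (o (Fin.last m)) v) (layerEmbed L (o (Fin.last m)) (Fin.init o)) by rw [ho],
    torusDist_layerEmbed]

/-- **Summing a function supported on one layer** = summing over the `m`-dimensional torus (the bookkeeping behind a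
cutoff function living on finitely many layers). [cite: KleinLandauShucker1981] -/
theorem sum_layer_eq_sum [NeZero L] (c : ZMod L) (G : TorusSite (m + 1) L → ℝ) :
    ∑ x : TorusSite (m + 1) L, (if x (Fin.last m) = c then G x else 0) = ∑ v : TorusSite m L, G (layerEmbed L c v) := by
  classical
  rw [← Finset.sum_filter]
  have hset : (Finset.univ.filter fun x : TorusSite (m + 1) L => x (Fin.last m) = c) =
      Finset.univ.map ⟨layerEmbed L c, layerEmbed_injective L c⟩ := by
    ext x
    simp only [Finset.mem_filter, Finset.mem_univ, true_and, Finset.mem_map, Function.Embedding.coeFn_mk]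
    constructor
    · intro hx
      exact ⟨Fin.init x, layerEmbed_init L hx⟩
    · rintro ⟨v, rfl⟩
      exact layerEmbed_last L c v
  rw [hset, Finset.sum_map]
  rfl

/-- In-plane steps stay in the layer: `(x + e_j)_{last} = x_{last}` for `j < m`. [folklore] -/
private theorem add_single_castSucc_last (x : TorusSite (m + 1) L) (j : Fin m) :
    (x + Pi.single (Fin.castSucc j) (1 : ZMod L) : TorusSite (m + 1) L) (Fin.last m) = x (Fin.last m) := by
  rw [Pi.add_apply, Pi.single_eq_of_ne (Fin.castSucc_lt_last j).ne', add_zero]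

/-- Vertical steps leave the layer: `(x + e_{last})_{last} ≠ x_{last}` (`L ≥ 2`). [folklore] -/
private theorem add_single_last_last_ne (hL : 2 ≤ L) (x : TorusSite (m + 1) L) :
    (x + Pi.single (Fin.last m) (1 : ZMod L) : TorusSite (m + 1) L) (Fin.last m) ≠ x (Fin.last m) := by
  haveI : Fact (1 < L) := ⟨by omega⟩
  rw [Pi.add_apply, Pi.single_eq_same]
  intro h
  exact one_ne_zero (add_eq_left.1 h)

variable (m)

/-- **The one-layer test function** `f(x) = [x_{last} = o_{last}] · g(dist(x, o))` of a radial profile `g`.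
[cite: KleinLandauShucker1981] -/
def layerProfile (g : ℕ → ℝ) (o x : TorusSite (m + 1) L) : ℝ :=
  if x (Fin.last m) = o (Fin.last m) then g (torusDist x o) else 0

variable {m L}

/-- Off the layer of `o` the test function vanishes. [folklore] -/
private theorem layerProfile_of_ne {g : ℕ → ℝ} {o x : TorusSite (m + 1) L} (hx : x (Fin.last m) ≠ o (Fin.last m)) :
    layerProfile m L g o x = 0 := if_neg hx

/-- On the layer of `o` the test function is the radial profile. [folklore] -/
private theorem layerProfile_of_eq {g : ℕ → ℝ} {o x : TorusSite (m + 1) L} (hx : x (Fin.last m) = o (Fin.last m)) :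
    layerProfile m L g o x = g (torusDist x o) := if_pos hx

/-- `f(o) = g(0)`. [folklore] -/
private theorem layerProfile_self (g : ℕ → ℝ) (o : TorusSite (m + 1) L) : layerProfile m L g o o = g 0 := by
  rw [layerProfile_of_eq rfl, torusDist_self]

/-- The test function at an embedded site of the layer of `o`: `f(ι v) = g(dist_m(v, init o))`. [folklore] -/
private theorem layerProfile_layerEmbed (g : ℕ → ℝ) (o : TorusSite (m + 1) L) (v : TorusSite m L) :
    layerProfile m L g o (layerEmbed L (o (Fin.last m)) v) = g (torusDist v (Fin.init o)) := by
  rw [layerProfile_of_eq (layerEmbed_last L _ v), torusDist_layerEmbed_self]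

/-- **The vertical Dirichlet sum of the one-layer test function**: `Σ_x (f_x − f_{x+e_{last}})² = 2 Σ_x f_x²` (`L ≥ 2`:
`x` and `x + e_{last}` never lie in the same layer, so the cross terms vanish). [cite: KleinLandauShucker1981] -/
theorem sum_sq_sub_vertical_eq [NeZero L] (hL : 2 ≤ L) (g : ℕ → ℝ) (o : TorusSite (m + 1) L) :
    ∑ x : TorusSite (m + 1) L, (layerProfile m L g o x - layerProfile m L g o (x + Pi.single (Fin.last m) 1)) ^ 2 =
      2 * ∑ x : TorusSite (m + 1) L, (layerProfile m L g o x) ^ 2 := by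
  have hcross : ∀ x : TorusSite (m + 1) L,
      layerProfile m L g o x * layerProfile m L g o (x + Pi.single (Fin.last m) 1) = 0 := by
    intro x
    by_cases hx : x (Fin.last m) = o (Fin.last m)
    · have hy : (x + Pi.single (Fin.last m) (1 : ZMod L) : TorusSite (m + 1) L) (Fin.last m) ≠ o (Fin.last m) := by
        rw [← hx]; exact add_single_last_last_ne L hL x
      rw [layerProfile_of_ne hy, mul_zero]
    · rw [layerProfile_of_ne hx, zero_mul]
  have hshift : ∑ x : TorusSite (m + 1) L, (layerProfile m L g o (x + Pi.single (Fin.last m) 1)) ^ 2 =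
      ∑ x : TorusSite (m + 1) L, (layerProfile m L g o x) ^ 2 :=
    Fintype.sum_equiv (Equiv.addRight (Pi.single (Fin.last m) (1 : ZMod L))) _ _ fun x => rfl
  calc ∑ x : TorusSite (m + 1) L, (layerProfile m L g o x - layerProfile m L g o (x + Pi.single (Fin.last m) 1)) ^ 2
      = ∑ x : TorusSite (m + 1) L, ((layerProfile m L g o x) ^ 2 +
          (layerProfile m L g o (x + Pi.single (Fin.last m) 1)) ^ 2) := by
        refine Finset.sum_congr rfl fun x _ => ?_
        have := hcross x
        nlinarith [hcross x]
    _ = 2 * ∑ x : TorusSite (m + 1) L, (layerProfile m L g o x) ^ 2 := by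
        rw [Finset.sum_add_distrib, hshift]; ring

/-- **The mass of the one-layer test function**: `Σ_x f_x² = Σ_{v ∈ (ℤ/Lℤ)^m} g(dist(v, o'))²` (the support term of the
layered cutoff). [cite: KleinLandauShucker1981] -/
theorem sum_sq_layerProfile_eq [NeZero L] (g : ℕ → ℝ) (o : TorusSite (m + 1) L) :
    ∑ x : TorusSite (m + 1) L, (layerProfile m L g o x) ^ 2 = ∑ v : TorusSite m L, (g (torusDist v (Fin.init o))) ^ 2 := by
  have h1 : ∀ x : TorusSite (m + 1) L, (layerProfile m L g o x) ^ 2 =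
      if x (Fin.last m) = o (Fin.last m) then (g (torusDist x o)) ^ 2 else 0 := by
    intro x
    by_cases hx : x (Fin.last m) = o (Fin.last m)
    · rw [if_pos hx, layerProfile_of_eq hx]
    · rw [if_neg hx, layerProfile_of_ne hx]; ring
  rw [Finset.sum_congr rfl fun x _ => h1 x, sum_layer_eq_sum]
  refine Finset.sum_congr rfl fun v _ => ?_
  have := layerProfile_layerEmbed g o v
  rw [layerProfile_of_eq (layerEmbed_last L _ v)] at this
  rw [this]

/-- **The in-plane Dirichlet sums of the one-layer test function**: for an in-plane direction `j`,
`Σ_x (f_x − f_{x+e_j})² ≤ 2 Σ_{v ∈ (ℤ/Lℤ)^m} (g(dist(v,o')) − g(dist(v,o') + 1))²` (along a bond the distance to `o` moves by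
at most one step; `L ≥ 2`). [cite: MerminWagnerPRL1966, p. 1134] -/
theorem sum_sq_sub_inPlane_le [NeZero L] (hL : 2 ≤ L) (g : ℕ → ℝ) (o : TorusSite (m + 1) L) (j : Fin m) :
    ∑ x : TorusSite (m + 1) L, (layerProfile m L g o x - layerProfile m L g o (x + Pi.single (Fin.castSucc j) 1)) ^ 2 ≤
      2 * ∑ v : TorusSite m L, (g (torusDist v (Fin.init o)) - g (torusDist v (Fin.init o) + 1)) ^ 2 := by
  haveI : Fact (1 < L) := ⟨by omega⟩
  set Φ : TorusSite (m + 1) L → ℝ := fun x =>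
    if x (Fin.last m) = o (Fin.last m) then (g (torusDist x o) - g (torusDist x o + 1)) ^ 2 else 0 with hΦ
  have hΦ0 : ∀ x, 0 ≤ Φ x := fun x => by
    simp only [hΦ]; split_ifs; exacts [sq_nonneg _, le_rfl]
  -- termwise: `(f_x − f_{x+e})² ≤ Φ x + Φ (x+e)`
  have hterm : ∀ x : TorusSite (m + 1) L,
      (layerProfile m L g o x - layerProfile m L g o (x + Pi.single (Fin.castSucc j) 1)) ^ 2 ≤
        Φ x + Φ (x + Pi.single (Fin.castSucc j) 1) := by
    intro x
    have hlast := add_single_castSucc_last L x j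
    by_cases hx : x (Fin.last m) = o (Fin.last m)
    · have hy : (x + Pi.single (Fin.castSucc j) (1 : ZMod L) : TorusSite (m + 1) L) (Fin.last m) = o (Fin.last m) := by
        rw [hlast, hx]
      rw [layerProfile_of_eq hx, layerProfile_of_eq hy]
      simp only [hΦ, if_pos hx, if_pos hy]
      have hadj : (torusGraph (m + 1) L).Adj x (x + Pi.single (Fin.castSucc j) 1) := by
        rw [torusGraph_adj_iff]
        refine ⟨fun h => ?_, Or.inl ⟨Fin.castSucc j, rfl⟩⟩
        have h2 := congrFun h (Fin.castSucc j)
        rw [Pi.add_apply, Pi.single_eq_same] at h2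
        exact one_ne_zero (add_eq_left.1 h2.symm)
      have hstep := torusDist_le_of_adj L hadj o
      exact sq_sub_le_of_step g hstep.2 hstep.1
    · have hy : (x + Pi.single (Fin.castSucc j) (1 : ZMod L) : TorusSite (m + 1) L) (Fin.last m) ≠ o (Fin.last m) := by
        rw [hlast]; exact hx
      rw [layerProfile_of_ne hx, layerProfile_of_ne hy, sub_zero, zero_pow two_ne_zero]
      exact add_nonneg (hΦ0 _) (hΦ0 _)
  have hshift : ∑ x : TorusSite (m + 1) L, Φ (x + Pi.single (Fin.castSucc j) 1) = ∑ x : TorusSite (m + 1) L, Φ x :=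
    Fintype.sum_equiv (Equiv.addRight (Pi.single (Fin.castSucc j) (1 : ZMod L))) _ _ fun x => rfl
  have hlayer : ∑ x : TorusSite (m + 1) L, Φ x =
      ∑ v : TorusSite m L, (g (torusDist v (Fin.init o)) - g (torusDist v (Fin.init o) + 1)) ^ 2 := by
    rw [hΦ, sum_layer_eq_sum]
    refine Finset.sum_congr rfl fun v _ => ?_
    rw [torusDist_layerEmbed_self]
  calc _ ≤ ∑ x : TorusSite (m + 1) L, (Φ x + Φ (x + Pi.single (Fin.castSucc j) 1)) := Finset.sum_le_sum fun x _ => hterm x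
    _ = 2 * ∑ x : TorusSite (m + 1) L, Φ x := by rw [Finset.sum_add_distrib, hshift]; ring
    _ = _ := by rw [hlayer]

end Layers

/-! ### §3 The layered Mermin–Wagner ceiling in finite volume, uniformly in the volume -/

section Ceiling

variable {m : ℕ} (L : ℕ) [NeZero L] (n : ℕ)

/-- The harmonic numbers `H_R = Σ_{k<R} 1/(k+1)` are positive for `R ≥ 1`. [folklore] -/
private theorem harmonic_pos {R : ℕ} (hR : 1 ≤ R) : 0 < ∑ k ∈ range R, (1 : ℝ) / (k + 1) :=
  lt_of_lt_of_le one_pos (one_le_sum_range_one_div_succ hR)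

/-- **THE LAYERED MERMIN–WAGNER CEILING (finite volume, uniform in `L`).** On the torus `(ℤ/Lℤ)^{m+1}`, `m ∈ {1, 2}`,
`L ≥ 3`, let `H_K = −Σ_x Σ_i K_i (S¹_xS¹_{x+e_i} + S²_xS²_{x+e_i})` (`xyAnisoTorus`, in-plane couplings `K_j`, `j < m`,
interlayer coupling `K_m`), `α ∈ {x, y}` a planar direction, `B` a uniform field, `β ≥ 0`. Then for every `R ≥ 1` and
every site `o`:
`(Re⟨S^α_o⟩_{β, H_K − BΣS^α})² ≤ β S² (2S² (16 (Σ_{j<m}|K_j|)/H_R + 8 |K_m| R²) + S |B| · 4R²)`, `H_R = Σ_{k<R} 1/(k+1)`,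
`S = n/2` — Bogoliubov's inequality with the one-layer harmonic test function. [cite: MerminWagnerPRL1966, pp. 1133–1135]
[cite: KleinLandauShucker1981] -/
theorem sq_re_gibbsState_planarSpin_le_layered (hm1 : 1 ≤ m) (hm2 : m ≤ 2) (hL : 3 ≤ L) (K : Fin (m + 1) → ℝ)
    {α : Fin 3} (hα : α ≠ 2) (B : ℝ) {β : ℝ} (hβ : 0 ≤ β) {R : ℕ} (hR : 1 ≤ R) (o : TorusSite (m + 1) L) :
    (gibbsState β (xyAnisoTorus L n K - (B : ℂ) • ∑ x, siteSpin n x α) (siteSpin n o α)).re ^ 2 ≤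
      β * ((n : ℝ) / 2) ^ 2 *
        (2 * ((n : ℝ) / 2) ^ 2 *
            (16 * (∑ j : Fin m, |K (Fin.castSucc j)|) / (∑ k ∈ range R, (1 : ℝ) / (k + 1)) +
              8 * |K (Fin.last m)| * (R : ℝ) ^ 2) +
          (n : ℝ) / 2 * (|B| * (4 * (R : ℝ) ^ 2))) := by
  set HR : ℝ := ∑ k ∈ range R, (1 : ℝ) / (k + 1) with hHR
  set g : ℕ → ℝ := fun r => (∑ k ∈ Ico r R, (1 : ℝ) / (k + 1)) / HR with hg
  set f : TorusSite (m + 1) L → ℝ := layerProfile m L g o with hf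
  have hL2 : 2 ≤ L := by omega
  have hHR0 : 0 < HR := harmonic_pos hR
  have hfo : f o = 1 := by
    rw [hf, layerProfile_self]
    exact harmonicProfile_zero hR
  have hgR : ∀ r, R ≤ r → g r = 0 := fun r hr => harmonicProfile_eq_zero hr
  have hloc := sq_re_gibbsState_planarSpin_le_xyWeighted L n (dirCoupling L K) (fun _ => B) hα hβ f o hfo
  have hfield : ((B : ℂ) • ∑ x : TorusSite (m + 1) L, siteSpin n x α : Op (TorusSite (m + 1) L) (n + 1)) =
      ∑ x : TorusSite (m + 1) L, ((B : ℝ) : ℂ) • siteSpin n x α := Finset.smul_sum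
  rw [xyAnisoTorus, hfield]
  refine hloc.trans ?_
  rw [sum_edgeFinset_abs_dirCoupling_mul_sq_sub L hL K f, Fin.sum_univ_castSucc]
  -- the mass of `f`
  have hF : ∑ x : TorusSite (m + 1) L, (f x) ^ 2 ≤ 4 * (R : ℝ) ^ 2 := by
    have h := sum_sq_layerProfile_eq g o
    rw [← hf] at h
    rw [h]
    have h1 := sum_radial_le_sum_range (L := L) hm1 hm2 (Φ := fun r => (g r) ^ 2)
      (fun r => sq_nonneg _) (R := R) (fun r hr => by
        simp only [hgR r hr, ne_eq, OfNat.ofNat_ne_zero, not_false_eq_true, zero_pow]) (Fin.init o)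
    have h2 : ∑ r ∈ range R, 4 * (2 * (r : ℝ) + 1) * (g r) ^ 2 ≤ ∑ r ∈ range R, 4 * (2 * (r : ℝ) + 1) * 1 := by
      refine sum_le_sum fun r _ => mul_le_mul_of_nonneg_left ?_ (by positivity)
      have h0 : 0 ≤ g r := harmonicProfile_nonneg R r
      have h1 : g r ≤ 1 := harmonicProfile_le_one R r
      nlinarith
    have h3 : ∑ r ∈ range R, 4 * (2 * (r : ℝ) + 1) * 1 = 4 * (R : ℝ) ^ 2 := by
      rw [← sum_range_two_mul_cast_add_one R, Finset.mul_sum]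
      refine sum_congr rfl fun r _ => ?_
      ring
    exact h1.trans (h2.trans h3.le)
  -- in-plane directions
  have hplane : ∀ j : Fin m,
      ∑ x : TorusSite (m + 1) L, (f x - f (x + Pi.single (Fin.castSucc j) 1)) ^ 2 ≤ 16 / HR := by
    intro j
    have h := sum_sq_sub_inPlane_le hL2 g o j
    rw [← hf] at h
    refine h.trans ?_
    have h2 := sum_radial_le_sum_range (L := L) hm1 hm2 (Φ := fun r => (g r - g (r + 1)) ^ 2)
      (fun r => sq_nonneg _) (R := R) (fun r hr => by
        simp only [hgR r hr, hgR (r + 1) (by omega), sub_self, ne_eq, OfNat.ofNat_ne_zero,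
          not_false_eq_true, zero_pow]) (Fin.init o)
    have h3 : ∑ r ∈ range R, 4 * (2 * (r : ℝ) + 1) * (g r - g (r + 1)) ^ 2 ≤ 8 / HR :=
      sum_shell_harmonicProfile_sq_le hR
    calc 2 * ∑ v : TorusSite m L, (g (torusDist v (Fin.init o)) - g (torusDist v (Fin.init o) + 1)) ^ 2
        ≤ 2 * (8 / HR) := mul_le_mul_of_nonneg_left (h2.trans h3) (by norm_num)
      _ = 16 / HR := by ring
  -- vertical direction
  have hvert : ∑ x : TorusSite (m + 1) L, (f x - f (x + Pi.single (Fin.last m) 1)) ^ 2 ≤ 8 * (R : ℝ) ^ 2 := by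
    have h := sum_sq_sub_vertical_eq hL2 g o
    rw [← hf] at h
    rw [h]
    linarith [hF]
  -- assemble
  have h1 : ∑ j : Fin m, |K (Fin.castSucc j)| *
      ∑ x : TorusSite (m + 1) L, (f x - f (x + Pi.single (Fin.castSucc j) 1)) ^ 2 ≤
      16 * (∑ j : Fin m, |K (Fin.castSucc j)|) / HR := by
    calc ∑ j : Fin m, |K (Fin.castSucc j)| * ∑ x : TorusSite (m + 1) L, (f x - f (x + Pi.single (Fin.castSucc j) 1)) ^ 2
        ≤ ∑ j : Fin m, |K (Fin.castSucc j)| * (16 / HR) :=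
          sum_le_sum fun j _ => mul_le_mul_of_nonneg_left (hplane j) (abs_nonneg _)
      _ = 16 * (∑ j : Fin m, |K (Fin.castSucc j)|) / HR := by rw [← Finset.sum_mul]; ring
  have h2 : |K (Fin.last m)| * ∑ x : TorusSite (m + 1) L, (f x - f (x + Pi.single (Fin.last m) 1)) ^ 2 ≤
      8 * |K (Fin.last m)| * (R : ℝ) ^ 2 :=
    (mul_le_mul_of_nonneg_left hvert (abs_nonneg _)).trans (le_of_eq (by ring))
  have h3 : ∑ x : TorusSite (m + 1) L, |B| * (f x) ^ 2 ≤ |B| * (4 * (R : ℝ) ^ 2) := by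
    rw [← Finset.mul_sum]
    exact mul_le_mul_of_nonneg_left hF (abs_nonneg _)
  have hS0 : (0 : ℝ) ≤ (n : ℝ) / 2 := by positivity
  exact mul_le_mul_of_nonneg_left (add_le_add (mul_le_mul_of_nonneg_left (add_le_add h1 h2) (by positivity))
    (mul_le_mul_of_nonneg_left h3 hS0)) (mul_nonneg hβ (sq_nonneg _))

end Ceiling

section Three

variable (L : ℕ) [NeZero L] (n : ℕ)

/-- **THE THREE-DIMENSIONAL LAYERED XY MODEL** (in-plane couplings `K₀, K₁`, interlayer coupling `K₂`; for `K = (1,1,r)`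
the model of the tree's RP floor `xyLayered_longRangeOrder`): on `(ℤ/Lℤ)³`, `L ≥ 3`, `α ∈ {x, y}`, `β ≥ 0`, every `R ≥ 1`:
`(Re⟨S^α_o⟩_{β, H_K − BΣS^α})² ≤ β S² (2S² (16(|K₀| + |K₁|)/H_R + 8|K₂|R²) + S|B|·4R²)`, uniformly in `L`.
[cite: MerminWagnerPRL1966, pp. 1133–1135] [cite: KleinLandauShucker1981] [cite: KLS1988JSP, eq. (5)] -/
theorem sq_re_gibbsState_planarSpin_le_layered_three (hL : 3 ≤ L) (K : Fin 3 → ℝ) {α : Fin 3} (hα : α ≠ 2)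
    (B : ℝ) {β : ℝ} (hβ : 0 ≤ β) {R : ℕ} (hR : 1 ≤ R) (o : TorusSite 3 L) :
    (gibbsState β (xyAnisoTorus L n K - (B : ℂ) • ∑ x, siteSpin n x α) (siteSpin n o α)).re ^ 2 ≤
      β * ((n : ℝ) / 2) ^ 2 *
        (2 * ((n : ℝ) / 2) ^ 2 *
            (16 * (|K 0| + |K 1|) / (∑ k ∈ range R, (1 : ℝ) / (k + 1)) + 8 * |K 2| * (R : ℝ) ^ 2) +
          (n : ℝ) / 2 * (|B| * (4 * (R : ℝ) ^ 2))) := by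
  have h := sq_re_gibbsState_planarSpin_le_layered L n (m := 2) (by norm_num) le_rfl hL K hα B hβ hR o
  simpa only [Fin.sum_univ_two, show Fin.castSucc (0 : Fin 2) = (0 : Fin 3) from rfl,
    show Fin.castSucc (1 : Fin 2) = (1 : Fin 3) from rfl, show Fin.last 2 = (2 : Fin 3) from rfl] using h

end Three

/-! ### §4 Infinite volume: the sourced limit states and the infinitesimal-field states of the layered model -/

section InfiniteVolume

variable {d n : ℕ}

/-- **A ceiling valid on all tori of side `≥ 4` passes to every sourced limit state** (the tree's
`XXZKT.IsSourcedLimit.sq_re_expect_siteSpinAt_le` asks for all sides `2k+2`; along the limit the sides diverge, so the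
tori with `k ≥ 1` suffice). [cite: KomaTasaki1993, §1 (1.8)–(1.9)] [cite: BratteliRobinsonII1997, §6.2.2] -/
theorem XXZKT.IsSourcedLimit.sq_re_expect_siteSpinAt_le_of_one_le
    {ρ : ∀ k : ℕ, Op (TorusSite d (2 * k + 2)) (n + 1) →ₗ[ℂ] ℂ} {ω : InfVolState d (n + 1)} {α : Fin 3}
    (h : XXZKT.IsSourcedLimit ρ ω) {M : ℝ}
    (hM : ∀ (k : ℕ), 1 ≤ k → ∀ (y : TorusSite d (2 * k + 2)), (ρ k (siteSpin n y α)).re ^ 2 ≤ M) (x : Site d) :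
    (ω.expect {x} (XXZKT.siteSpinAt n x α)).re ^ 2 ≤ M := by
  obtain ⟨κ, hκ, hω⟩ := h
  have ht := ((Complex.continuous_re.tendsto _).comp (hω.tendsto_onSite x (spinVec n α))).pow 2
  refine le_of_tendsto ht (Filter.eventually_atTop.2 ⟨1, fun j hj => ?_⟩)
  rw [Function.comp_apply, show (onSite (Torus.proj (2 * κ j + 2) x) (spinVec n α) :
      Op (TorusSite d (2 * κ j + 2)) (n + 1)) = siteSpin n (Torus.proj (2 * κ j + 2) x) α from rfl]
  exact hM (κ j) (hj.trans (hκ.id_le j)) _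

variable {m : ℕ} (n)

/-- **MERMIN–WAGNER CEILING FOR THE SOURCED THERMAL LIMIT STATES OF THE LAYERED XY MODEL.** For `m ∈ {1,2}`, `β ≥ 0`,
a planar source direction `α ∈ {x, y}` and source strength `B`, every thermodynamic limit
`ω = lim_Λ ⟨·⟩_{β, H_K − BΣ_x S^α_x}` along even tori (`XXZKT.IsSourcedLimit` of the sourced Gibbs family) satisfies at
every site of `ℤ^{m+1}` and for every `R ≥ 1`:
`(Re ω(S^α_x))² ≤ β S² (2S² (16 ΣK_∥/H_R + 8|K_⊥|R²) + S|B|·4R²)`. [cite: MerminWagnerPRL1966, pp. 1133–1135]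
[cite: KomaTasaki1993, §1 (1.8)–(1.9)] -/
theorem layeredXY_sourcedLimit_sq_re_expect_le (hm1 : 1 ≤ m) (hm2 : m ≤ 2) (K : Fin (m + 1) → ℝ) {α : Fin 3}
    (hα : α ≠ 2) {β : ℝ} (hβ : 0 ≤ β) (B : ℝ) {ω : InfVolState (m + 1) (n + 1)}
    (h : XXZKT.IsSourcedLimit
      (fun k => gibbsState β (xyAnisoTorus (2 * k + 2) n K - (B : ℂ) • ∑ x, siteSpin n x α)) ω)
    {R : ℕ} (hR : 1 ≤ R) (x : Site (m + 1)) :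
    (ω.expect {x} (XXZKT.siteSpinAt n x α)).re ^ 2 ≤
      β * ((n : ℝ) / 2) ^ 2 *
        (2 * ((n : ℝ) / 2) ^ 2 *
            (16 * (∑ j : Fin m, |K (Fin.castSucc j)|) / (∑ k ∈ range R, (1 : ℝ) / (k + 1)) +
              8 * |K (Fin.last m)| * (R : ℝ) ^ 2) +
          (n : ℝ) / 2 * (|B| * (4 * (R : ℝ) ^ 2))) :=
  h.sq_re_expect_siteSpinAt_le_of_one_le
    (fun k hk y => sq_re_gibbsState_planarSpin_le_layered (2 * k + 2) n hm1 hm2 (by omega) K hα B hβ hR y) x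

/-- **MERMIN–WAGNER CEILING FOR THE INFINITESIMAL-FIELD STATES OF THE LAYERED XY MODEL (KT93 (1.8)).** Every
infinitesimal-field state `ω̃ = lim_{B↓0} lim_Λ ⟨·⟩_{β, H_K − BΣS^α}` (`XXZKT.IsInfinitesimalFieldState` of the sourced Gibbs
family) satisfies, at every site and for every `R ≥ 1`, the field-free ceiling
`(Re ω̃(S^α_x))² ≤ β S² · 2S² (16 ΣK_∥/H_R + 8|K_⊥|R²)`: the spontaneous planar magnetisation of weakly coupled
layers is `O(√β (ΣK_∥/log R + |K_⊥|R²)^{1/2})` for every scale `R`. [cite: MerminWagnerPRL1966, pp. 1133–1135]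
[cite: KomaTasaki1993, §1 (1.8)–(1.9)] [cite: KleinLandauShucker1981] -/
theorem layeredXY_infinitesimalField_sq_re_expect_le (hm1 : 1 ≤ m) (hm2 : m ≤ 2) (K : Fin (m + 1) → ℝ)
    {α : Fin 3} (hα : α ≠ 2) {β : ℝ} (hβ : 0 ≤ β) {ω : InfVolState (m + 1) (n + 1)}
    (h : XXZKT.IsInfinitesimalFieldState
      (fun B k => gibbsState β (xyAnisoTorus (2 * k + 2) n K - (B : ℂ) • ∑ x, siteSpin n x α)) ω)
    {R : ℕ} (hR : 1 ≤ R) (x : Site (m + 1)) :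
    (ω.expect {x} (XXZKT.siteSpinAt n x α)).re ^ 2 ≤
      β * ((n : ℝ) / 2) ^ 2 * (2 * ((n : ℝ) / 2) ^ 2 *
        (16 * (∑ j : Fin m, |K (Fin.castSucc j)|) / (∑ k ∈ range R, (1 : ℝ) / (k + 1)) +
          8 * |K (Fin.last m)| * (R : ℝ) ^ 2)) := by
  refine XXZKT.IsInfinitesimalFieldState.sq_re_expect_siteSpinAt_le h
    (M₁ := β * ((n : ℝ) / 2) ^ 2 * ((n : ℝ) / 2 * (4 * (R : ℝ) ^ 2))) (fun B hB ω' hω' y => ?_) x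
  have h1 := layeredXY_sourcedLimit_sq_re_expect_le n hm1 hm2 K hα hβ B hω' hR y
  rw [abs_of_pos hB] at h1
  refine h1.trans (le_of_eq ?_)
  ring

/-- **DECOUPLED LAYERS (`K_⊥ = 0`): NO SPONTANEOUS PLANAR MAGNETISATION AT ANY `T > 0`** — each infinitesimal-field
state of a stack of uncoupled planes (or chains) has `ω̃(S^α_x) = 0` at every site (the two-dimensional Mermin–Wagner
theorem, recovered as the case `K_⊥ = 0`, `R → ∞` of the layered ceiling). [cite: MerminWagnerPRL1966, pp. 1133–1135] -/
theorem layeredXY_infinitesimalField_expect_eq_zero_of_decoupled (hm1 : 1 ≤ m) (hm2 : m ≤ 2) (K : Fin (m + 1) → ℝ)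
    (hK : K (Fin.last m) = 0) {α : Fin 3} (hα : α ≠ 2) {β : ℝ} (hβ : 0 ≤ β) {ω : InfVolState (m + 1) (n + 1)}
    (h : XXZKT.IsInfinitesimalFieldState
      (fun B k => gibbsState β (xyAnisoTorus (2 * k + 2) n K - (B : ℂ) • ∑ x, siteSpin n x α)) ω)
    (x : Site (m + 1)) :
    ω.expect {x} (XXZKT.siteSpinAt n x α) = 0 := by
  set S : ℝ := (n : ℝ) / 2 with hS
  set c : ℝ := β * S ^ 2 * (2 * S ^ 2) * (16 * ∑ j : Fin m, |K (Fin.castSucc j)|) with hc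
  have hc0 : 0 ≤ c := by positivity
  have hsq : ∀ {R : ℕ}, 1 ≤ R →
      (ω.expect {x} (XXZKT.siteSpinAt n x α)).re ^ 2 ≤ c / ∑ k ∈ range R, (1 : ℝ) / (k + 1) := by
    intro R hR
    have h1 := layeredXY_infinitesimalField_sq_re_expect_le n hm1 hm2 K hα hβ h hR x
    rw [hK, abs_zero] at h1
    refine h1.trans (le_of_eq ?_)
    rw [hc, hS]
    ring
  have hre0 : (ω.expect {x} (XXZKT.siteSpinAt n x α)).re ^ 2 ≤ 0 := by
    refine le_of_forall_pos_le_add fun ε hε => ?_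
    obtain ⟨R, hR, hRge⟩ := exists_harmonicSum_ge (c / ε)
    have hH0 : 0 < ∑ k ∈ range R, (1 : ℝ) / (k + 1) := by linarith [one_le_sum_range_one_div_succ hR]
    have hfin : c / ∑ k ∈ range R, (1 : ℝ) / (k + 1) ≤ ε := by
      rw [div_le_iff₀ hH0]
      have := (div_le_iff₀ hε).1 hRge
      linarith
    linarith [hsq hR]
  have hre : (ω.expect {x} (XXZKT.siteSpinAt n x α)).re = 0 :=
    pow_eq_zero_iff (n := 2) (by norm_num) |>.1 (le_antisymm hre0 (sq_nonneg _))
  have him : (ω.expect {x} (XXZKT.siteSpinAt n x α)).im = 0 :=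
    ω.im_expect_eq_zero_of_isHermitian {x} (siteSpin_isHermitian n _ α)
  exact Complex.ext hre him

/-- **THE ORDER PARAMETER OF WEAKLY COUPLED LAYERS VANISHES AS THE LAYERS DECOUPLE, UNIFORMLY** (fixed `β`, spin and
in-plane coupling budget `κ`): for every `ε > 0` there is `δ > 0` such that every infinitesimal-field state of every layered
XY model with `Σ_{j<m}|K_j| ≤ κ` and `|K_⊥| ≤ δ` has `(Re ω̃(S^α_x))² ≤ ε` at every site. (First the scale `R` with
`16 c κ/H_R ≤ ε/2`, then `δ` with `8 c δ R² ≤ ε/2`, `c = 2βS⁴`.) [cite: MerminWagnerPRL1966, pp. 1133–1135]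
[cite: KleinLandauShucker1981] -/
theorem layeredXY_infinitesimalField_sq_re_expect_le_of_interlayer_small (hm1 : 1 ≤ m) (hm2 : m ≤ 2)
    {α : Fin 3} (hα : α ≠ 2) {β : ℝ} (hβ : 0 ≤ β) (κ : ℝ) {ε : ℝ} (hε : 0 < ε) :
    ∃ δ : ℝ, 0 < δ ∧ ∀ K : Fin (m + 1) → ℝ, (∑ j : Fin m, |K (Fin.castSucc j)|) ≤ κ → |K (Fin.last m)| ≤ δ →
      ∀ ω : InfVolState (m + 1) (n + 1),
        XXZKT.IsInfinitesimalFieldState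
          (fun B k => gibbsState β (xyAnisoTorus (2 * k + 2) n K - (B : ℂ) • ∑ x, siteSpin n x α)) ω →
        ∀ x : Site (m + 1), (ω.expect {x} (XXZKT.siteSpinAt n x α)).re ^ 2 ≤ ε := by
  set S : ℝ := (n : ℝ) / 2 with hS
  set c : ℝ := β * S ^ 2 * (2 * S ^ 2) with hc
  have hc0 : 0 ≤ c := by positivity
  -- the in-plane scale
  obtain ⟨R, hR, hRge⟩ := exists_harmonicSum_ge (32 * c * |κ| / ε)
  set H : ℝ := ∑ k ∈ range R, (1 : ℝ) / (k + 1) with hH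
  have hH0 : 0 < H := by linarith [one_le_sum_range_one_div_succ hR]
  -- the interlayer budget
  refine ⟨ε / (2 * (8 * c * (R : ℝ) ^ 2 + 1)), by positivity, fun K hKpar hKperp ω hω x => ?_⟩
  have hmain := layeredXY_infinitesimalField_sq_re_expect_le n hm1 hm2 K hα hβ hω hR x
  have hpar0 : 0 ≤ ∑ j : Fin m, |K (Fin.castSucc j)| := Finset.sum_nonneg fun _ _ => abs_nonneg _
  -- in-plane term `≤ ε/2`
  have h1 : c * (16 * (∑ j : Fin m, |K (Fin.castSucc j)|) / H) ≤ ε / 2 := by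
    have hκ : (∑ j : Fin m, |K (Fin.castSucc j)|) ≤ |κ| := hKpar.trans (le_abs_self κ)
    have h32 : 32 * c * |κ| ≤ ε * H := by
      have := (div_le_iff₀ hε).1 hRge
      linarith
    rw [mul_div_assoc', div_le_iff₀ hH0]
    nlinarith [mul_le_mul_of_nonneg_left hκ hc0]
  -- interlayer term `≤ ε/2`
  have h2 : c * (8 * |K (Fin.last m)| * (R : ℝ) ^ 2) ≤ ε / 2 := by
    have hden : 0 < 8 * c * (R : ℝ) ^ 2 + 1 := by positivity
    have hδ : |K (Fin.last m)| * (8 * c * (R : ℝ) ^ 2 + 1) ≤ ε / 2 := by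
      have := (le_div_iff₀ (by positivity : (0 : ℝ) < 2 * (8 * c * (R : ℝ) ^ 2 + 1))).1 hKperp
      linarith
    nlinarith [abs_nonneg (K (Fin.last m)), mul_nonneg hc0 (sq_nonneg (R : ℝ))]
  calc (ω.expect {x} (XXZKT.siteSpinAt n x α)).re ^ 2
      ≤ c * (16 * (∑ j : Fin m, |K (Fin.castSucc j)|) / H + 8 * |K (Fin.last m)| * (R : ℝ) ^ 2) := by
        rw [hc, hS, hH]; exact le_of_le_of_eq hmain (by ring)
    _ = c * (16 * (∑ j : Fin m, |K (Fin.castSucc j)|) / H) + c * (8 * |K (Fin.last m)| * (R : ℝ) ^ 2) := mul_add _ _ _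
    _ ≤ ε / 2 + ε / 2 := add_le_add h1 h2
    _ = ε := by ring

/-- **Infinitesimal-field states of the layered XY model exist** for every `β`, source direction and couplings (compactness
twice; the sourced Gibbs states are states). [cite: KomaTasaki1993, §1 (1.8)] [cite: BratteliRobinsonI1987, Thm. 2.3.15] -/
theorem exists_layeredXY_infinitesimalFieldState (K : Fin (m + 1) → ℝ) (α : Fin 3) (β : ℝ) :
    ∃ ω : InfVolState (m + 1) (n + 1), XXZKT.IsInfinitesimalFieldState
      (fun B k => gibbsState β (xyAnisoTorus (2 * k + 2) n K - (B : ℂ) • ∑ x, siteSpin n x α)) ω := by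
  have hH : ∀ (B : ℝ) (k : ℕ), (xyAnisoTorus (2 * k + 2) n K - (B : ℂ) • ∑ x, siteSpin n x α :
      Op (TorusSite (m + 1) (2 * k + 2)) (n + 1)).IsHermitian := by
    intro B k
    rw [Finset.smul_sum]
    exact (xyAnisoTorus_isHermitian (2 * k + 2) n K).sub (sum_smul_siteSpin_isHermitian n (fun _ => B) α)
  exact XXZKT.exists_isInfinitesimalFieldState _
    (fun B k => gibbsState_one β _ (partitionFn_pos β (hH B k)).ne')
    fun B k X => gibbsState_nonneg_of_posSemidef β (hH B k) (posSemidef_conjTranspose_mul_self X)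

end InfiniteVolume

/-! ### §5 The explicit logarithm: `H_R ≥ log(R+1)` -/

section Log

/-- `log(R+1) ≤ H_R = Σ_{k<R} 1/(k+1)` (Mathlib's `log_add_one_le_harmonic`, cast to the tree's real harmonic sum). [folklore] -/
private theorem log_succ_le_harmonicSum (R : ℕ) : Real.log ((R : ℝ) + 1) ≤ ∑ k ∈ range R, (1 : ℝ) / (k + 1) := by
  have h := log_add_one_le_harmonic R
  have e : ((harmonic R : ℚ) : ℝ) = ∑ k ∈ range R, (1 : ℝ) / (k + 1) := by
    simp only [harmonic, Rat.cast_sum, Rat.cast_inv, Rat.cast_add, Rat.cast_one, Rat.cast_natCast, Nat.cast_add,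
      Nat.cast_one, one_div]
  rw [e] at h
  exact_mod_cast h

variable {m : ℕ} (n : ℕ)

/-- **THE `1/log` LAW FOR WEAKLY COUPLED XY LAYERS.** Every infinitesimal-field state of the layered XY model obeys, for every
integer scale `R ≥ 1`, `(Re ω̃(S^α_x))² ≤ β S² · 2S² (16 ΣK_∥ / log(R+1) + 8|K_⊥| R²)`; e.g. `R ≍ |K_⊥|^{-1/4}` gives
`O(β S⁴ (ΣK_∥ + 1)/log(1/|K_⊥|))`: an in-plane order parameter of size `m₀` in weakly coupled layers requires
`β ≳ m₀² log(1/|K_⊥|)`. [cite: MerminWagnerPRL1966, pp. 1133–1135] [cite: KleinLandauShucker1981] -/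
theorem layeredXY_infinitesimalField_sq_re_expect_le_log (hm1 : 1 ≤ m) (hm2 : m ≤ 2) (K : Fin (m + 1) → ℝ)
    {α : Fin 3} (hα : α ≠ 2) {β : ℝ} (hβ : 0 ≤ β) {ω : InfVolState (m + 1) (n + 1)}
    (h : XXZKT.IsInfinitesimalFieldState
      (fun B k => gibbsState β (xyAnisoTorus (2 * k + 2) n K - (B : ℂ) • ∑ x, siteSpin n x α)) ω)
    {R : ℕ} (hR : 1 ≤ R) (x : Site (m + 1)) :
    (ω.expect {x} (XXZKT.siteSpinAt n x α)).re ^ 2 ≤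
      β * ((n : ℝ) / 2) ^ 2 * (2 * ((n : ℝ) / 2) ^ 2 *
        (16 * (∑ j : Fin m, |K (Fin.castSucc j)|) / Real.log ((R : ℝ) + 1) + 8 * |K (Fin.last m)| * (R : ℝ) ^ 2)) := by
  have h1 := layeredXY_infinitesimalField_sq_re_expect_le n hm1 hm2 K hα hβ h hR x
  refine h1.trans (mul_le_mul_of_nonneg_left (mul_le_mul_of_nonneg_left (add_le_add ?_ le_rfl) (by positivity))
    (by positivity))
  have hlog : 0 < Real.log ((R : ℝ) + 1) := Real.log_pos (by
    have : (1 : ℝ) ≤ R := by exact_mod_cast hR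
    linarith)
  have hpar0 : 0 ≤ 16 * ∑ j : Fin m, |K (Fin.castSucc j)| :=
    mul_nonneg (by norm_num) (Finset.sum_nonneg fun _ _ => abs_nonneg _)
  exact div_le_div_of_nonneg_left hpar0 hlog (log_succ_le_harmonicSum R)

end Log

end Literature.MathematicalPhysics.QuantumLattice

end
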